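import Summits.BirchSwinnertonDyer.BirchSwinnertonDyer.Theorems.EdixhovenFibreFiveSevenStarredOptimalManinUnitFiveSevenAssembly
import Summits.BirchSwinnertonDyer.BirchSwinnertonDyer.Theorems.EdixhovenFibreFiveSevenTwistDegreeStepFiveSevenOfKatoTransfer
import Summits.BirchSwinnertonDyer.BirchSwinnertonDyer.Theorems.EdixhovenFibreFiveSevenTwistDegreeStepOrdinary
import Summits.BirchSwinnertonDyer.BirchSwinnertonDyer.Theorems.TeichmullerTwistDescentCellsOfKato
import HarnessLib

/-!
# Route `EdixhovenFibreFiveSeven` — the Manin cruxes GRANTED the four cite-only inputs of the assembled F″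
# (TDS57 22227, KP57 23810, TDS11 22228, CORNER 23883, LOW 23884; K★ 22226 is the sibling file
# `…StarredOptimalManinUnitFiveSevenOfSL2NeronValues`, AKR #7 20709 the file `…ManinFrameResidueProperROfSL2NeronValues`)

TOOL theorems only (no definition, no named fact, no `sorry`): the crux decls TDS57 / KP57 / TDS11 / CORNER / LOW of the route file
`Theses/EdixhovenFibreFiveSeven.lean` BY NAME from the displayed hypotheses
`exists_smul_range_expStarCoord_tower_iff_trace_log` ((S5b-tower), Kato II Thm. 1.4.1 + BK90 §3),
`cupLogInjective_and_hasDualExp_of_isDeRham` (Kato II Prop. 1.2.3), `isDeRham_restrictedRationalTateRep`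
(Fontaine / Kato II Ex. 1.3.5) and `Kato2004.exists_member_sl2ZetaElement_neron_values` (P1: Kato 2004 (8.1.3),
Thm. 9.7, Thm. 6.6 (1), Thm. 13.6 at Kato's member, Néron-pinned) — plus modularity `exists_isNewformOf` where the
landed closer displays it — by composing the landed `…_of_kato` closers with the final assembly
`KatoAssemblySocket.kato_neron_five_le_of_sl2NeronValues` (F″ ⟸ the four inputs). CONDITIONAL RESULTS: the four
inputs are cite-only Literature facts without `_holds`; no item is closed by this file; BSD is not proved by any of this.

References: [Kato2004Asterisque] (8.1.3) p. 180, Thm. 9.7 p. 189, Thm. 6.6 (1) p. 163, Thm. 13.6 p. 227;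
[Kato1993LNM1553] Ch. II Prop. 1.2.3, Ex. 1.3.5, Thm. 1.4.1; [BlochKato1990] Prop. 3.8, Ex. 3.11;
[KostersPannekoek2017] Thm. 1, Cor. 2; [EdixhovenManin1991] Thm. 3.
-/

set_option autoImplicit false
-- the Theorems namespace of a single-conjunct summit repeats the summit name by design (D-0017)
set_option linter.dupNamespace false

noncomputable section

open Literature.NumberTheory.PAdicHodge
open Literature.NumberTheory.EllipticCurves Literature.NumberTheory.EllipticCurves.ModularForms
open Literature.NumberTheory.EllipticCurves.Kato2004
open Summit.BirchSwinnertonDyer.BirchSwinnertonDyer.Theses.EdixhovenFibreFiveSeven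

namespace Summit.BirchSwinnertonDyer.BirchSwinnertonDyer.Theorems.KatoSl2NeronClosers

/-- **TDS57 `TwistDegreeStepFiveSeven` (stmt-BirchSwinnertonDyer-22227) GRANTED the four inputs of the assembled F″**
(modularity is the decl's own first binder), by `LTwistTransfer.twistDegreeStepFiveSeven_of_kato` (Ihara-free transfer
L-TWIST with its Chebotarev witness discharged) `∘ kato_neron_five_le_of_sl2NeronValues`. CONDITIONAL; the item is not
closed by this. [cite: Kato2004Asterisque, (8.1.3) (p. 180), Thm. 9.7 (p. 189)] [cite: Kato1993LNM1553, Ch. II Thm. 1.4.1 (3)-(4)] -/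
theorem twistDegreeStepFiveSeven_of_sl2NeronValues
    (hT₂ : exists_smul_range_expStarCoord_tower_iff_trace_log)
    (hP : cupLogInjective_and_hasDualExp_of_isDeRham)
    (hDR : isDeRham_restrictedRationalTateRep)
    (hP1 : exists_member_sl2ZetaElement_neron_values) :
    TwistDegreeStepFiveSeven :=
  LTwistTransfer.twistDegreeStepFiveSeven_of_kato
    (KatoAssemblySocket.kato_neron_five_le_of_sl2NeronValues hT₂ hP hDR hP1)

/-- **KP57 `KPResidueManinUnitFiveSeven` (stmt-BirchSwinnertonDyer-23810) GRANTED modularity and the four inputs of the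
assembled F″**, by `LTwistTransfer.kpResidueManinUnitFiveSeven_of_kato ∘ kato_neron_five_le_of_sl2NeronValues`.
CONDITIONAL; the item is not closed by this. [cite: KostersPannekoek2017, Thm. 1 and Cor. 2]
[cite: Kato2004Asterisque, (8.1.3) (p. 180), Thm. 9.7 (p. 189)] -/
theorem kpResidueManinUnitFiveSeven_of_sl2NeronValues (hnf : exists_isNewformOf)
    (hT₂ : exists_smul_range_expStarCoord_tower_iff_trace_log)
    (hP : cupLogInjective_and_hasDualExp_of_isDeRham)
    (hDR : isDeRham_restrictedRationalTateRep)
    (hP1 : exists_member_sl2ZetaElement_neron_values) :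
    KPResidueManinUnitFiveSeven :=
  LTwistTransfer.kpResidueManinUnitFiveSeven_of_kato hnf
    (KatoAssemblySocket.kato_neron_five_le_of_sl2NeronValues hT₂ hP hDR hP1)

/-- **TDS11 `TwistDegreeStepOrdinary` (stmt-BirchSwinnertonDyer-22228) GRANTED the four inputs of the assembled F″**
(the `p ≥ 11` reading of F″ is its `7 < p` disjunct), by
`EdixhovenFibreFiveSevenTwistDegreeStepOrdinary.twistDegreeStepOrdinary_of_kato_five_le ∘ kato_neron_five_le_of_sl2NeronValues`.
CONDITIONAL; the item is not closed by this. [cite: Kato2004Asterisque, (8.1.3) (p. 180), Thm. 9.7 (p. 189)]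
[cite: EdixhovenManin1991, §4] -/
theorem twistDegreeStepOrdinary_of_sl2NeronValues
    (hT₂ : exists_smul_range_expStarCoord_tower_iff_trace_log)
    (hP : cupLogInjective_and_hasDualExp_of_isDeRham)
    (hDR : isDeRham_restrictedRationalTateRep)
    (hP1 : exists_member_sl2ZetaElement_neron_values) :
    TwistDegreeStepOrdinary :=
  EdixhovenFibreFiveSevenTwistDegreeStepOrdinary.twistDegreeStepOrdinary_of_kato_five_le
    (KatoAssemblySocket.kato_neron_five_le_of_sl2NeronValues hT₂ hP hDR hP1)

/-- **CORNER `KummerCornerTorsionOptimalManinUnit` (stmt-BirchSwinnertonDyer-23883; this route's copy of the decl)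
GRANTED modularity and the four inputs of the assembled F″** — the Kosters–Pannekoek corner III@5 / II@7 with a
`ℚ_p`-rational point of order `p`, reached by Kato + unit twist + transfer in the sibling route's
`TeichmullerTwistDescent.kummerCornerTorsionOptimalManinUnit_of_kato` (same signature; the two route copies agree
definitionally). CONDITIONAL; the item is not closed by this. [cite: KostersPannekoek2017, Cor. 2]
[cite: Kato2004Asterisque, Thm. 9.7 (p. 189)] -/
theorem kummerCornerTorsionOptimalManinUnit_of_sl2NeronValues (hnf : exists_isNewformOf)
    (hT₂ : exists_smul_range_expStarCoord_tower_iff_trace_log)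
    (hP : cupLogInjective_and_hasDualExp_of_isDeRham)
    (hDR : isDeRham_restrictedRationalTateRep)
    (hP1 : exists_member_sl2ZetaElement_neron_values) :
    KummerCornerTorsionOptimalManinUnit :=
  fun W _ _ p _ _ D hcell hadd hirr hG hP0 hopt ↦
    TeichmullerTwistDescent.kummerCornerTorsionOptimalManinUnit_of_kato hnf
      (KatoAssemblySocket.kato_neron_five_le_of_sl2NeronValues hT₂ hP hDR hP1) W p D hcell hadd hirr hG hP0 hopt

/-- **LOW `SupersingularTorsionOptimalManinUnitFive` (stmt-BirchSwinnertonDyer-23884; this route's copy of the decl)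
GRANTED modularity and the four inputs of the assembled F″** (II@5, potentially supersingular, with a `ℚ_5`-rational
point of order 5), via the sibling route's `TeichmullerTwistDescent.supersingularTorsionOptimalManinUnitFive_of_kato`
(same signature). CONDITIONAL; the item is not closed by this. [cite: KostersPannekoek2017, Cor. 2]
[cite: Kato2004Asterisque, Thm. 9.7 (p. 189)] -/
theorem supersingularTorsionOptimalManinUnitFive_of_sl2NeronValues (hnf : exists_isNewformOf)
    (hT₂ : exists_smul_range_expStarCoord_tower_iff_trace_log)
    (hP : cupLogInjective_and_hasDualExp_of_isDeRham)
    (hDR : isDeRham_restrictedRationalTateRep)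
    (hP1 : exists_member_sl2ZetaElement_neron_values) :
    SupersingularTorsionOptimalManinUnitFive :=
  fun W _ _ p _ _ D hcell hadd hirr hG hP0 hopt ↦
    TeichmullerTwistDescent.supersingularTorsionOptimalManinUnitFive_of_kato hnf
      (KatoAssemblySocket.kato_neron_five_le_of_sl2NeronValues hT₂ hP hDR hP1) W p D hcell hadd hirr hG hP0 hopt

end Summit.BirchSwinnertonDyer.BirchSwinnertonDyer.Theorems.KatoSl2NeronClosers

end
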